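import Summits.ValiantsHypothesis.ValiantsHypothesis.Theorems.BarrierLeverChowHitsPartitionMinorsRFacePrivateColumns
import Summits.ValiantsHypothesis.ValiantsHypothesis.Theorems.BarrierLeverChowHitsPartitionMinorsRFacePrivateLeading

/-!
# Route BarrierLever — item `ChowHitsPartitionMinorsR` (stmt-ValiantsHypothesis-21882):
# THEOREM FP — a lower-set row family against ANY column family is hit by `Σ_j |w j|` affine forms

Helper file (`--supports stmt-ValiantsHypothesis-21882`; cell valiant-natproofs, rung V4, 𝒟-side
support item of route BarrierLever; prover seat val-np-p5 gen 29). Definition-free. Closes NO item.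

THE DESIGN (seat memo MEMO-21882-valnp5-g29.md §6). Rows `u : Fin r → Finset (Fin h)` injective with
lower-set range, columns `w : Fin r → Finset (Fin h)` injective (arbitrary sets). Label the columns by
the faces through a permutation `σ` with `w j = ∅ ⇒ u (σ j) = ∅`. For each nonempty column `j`
(`n_j = |w j|`) take the `n_j` affine forms `1 − X_{u(σ j)} + ζ_j^k s_j Y_{w j}` (`k < n_j`), `ζ_j`
a primitive `n_j`-th root of unity and `s_j = ρ_j u^{h!/n_j}` with `−(−ρ_j)^{n_j} n_j! = 1`, over the
coefficient ring `ℂ[u]`. By `…FacePrivatePrelims` each group has the partition coefficients of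
`(1 − X_{u(σ j)})^{n_j}` plus `t := u^{h!}` at `(∅, w j)` (`coeff_partitionExpo_designGroup`); by
`…FacePrivateColumns` the partition matrix is `(A + t·R) · diag(t or 1)` (`coeff_prod_groups_fin`)
with `A` the leading matrix of `…FacePrivateLeading`, which is nonsingular, so the determinant is a
nonzero polynomial in `u` (`det_ne_zero_of_columns`), and some complex value of `u` gives the witness.

* `chowHits_of_lowerRows` — **THEOREM FP**: lower-set rows × any injective columns, `Σ_j |w j|`
  forms. The planner's arrows G1 (`chowHits_of_thin`) and G2 (`exists_chow_of_thinLowerSets`) are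
  in the companion file `…FacePrivateThin`.

WHAT THIS IS NOT: item 21882 is NOT proved (layouts with both families of total size `> h·h − h`
remain — the «thick» residual class of the memo); nothing on crux stmt-ValiantsHypothesis-14610 or on
`VP` versus `VNP`.
-/

set_option linter.dupNamespace false

namespace Summit.ValiantsHypothesis.ValiantsHypothesis.Theorems.BarrierLever.ChowFacePrivate

open Finset MvPolynomial

noncomputable section

variable {h r : ℕ}

/-! ## 1. Small ingredients -/

/-- A permutation labelling the (unique, if any) empty column by the (existing) empty row. -/
theorem exists_perm_label (u w : Fin r → Finset (Fin h)) (hw : Function.Injective w)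
    (hlow : ∀ i S, S ⊆ u i → ∃ k, u k = S) :
    ∃ σ : Equiv.Perm (Fin r), ∀ j, w j = ∅ → u (σ j) = ∅ := by
  classical
  by_cases hex : ∃ j₀, w j₀ = ∅
  · obtain ⟨j₀, hj₀⟩ := hex
    obtain ⟨i₀, hi₀⟩ := hlow j₀ ∅ (Finset.empty_subset _)
    refine ⟨Equiv.swap j₀ i₀, fun j hj => ?_⟩
    have hjj : j = j₀ := hw (by rw [hj, hj₀])
    subst hjj
    rw [Equiv.swap_apply_left, hi₀]
  · exact ⟨Equiv.refl _, fun j hj => absurd ⟨j, hj⟩ hex⟩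

/-- The scaling constant: `ρ` with `−(−ρ)^n · n! = 1`. -/
theorem exists_root_const (n : ℕ) (hn : 0 < n) : ∃ ρ : ℂ, -((-ρ) ^ n * (n.factorial : ℂ)) = 1 := by
  obtain ⟨z, hz⟩ := IsAlgClosed.exists_pow_nat_eq (-((n.factorial : ℂ))⁻¹) hn
  refine ⟨-z, ?_⟩
  have : (n.factorial : ℂ) ≠ 0 := Nat.cast_ne_zero.mpr (Nat.factorial_ne_zero n)
  rw [neg_neg, hz, neg_mul, neg_neg, inv_mul_cancel₀ this]

/-- An affine form `1 + C a · X_V + C b · Y_W` has total degree `≤ 1`. -/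
theorem totalDegree_affine_le {R : Type*} [CommSemiring R] [Nontrivial R] (a b : R)
    (V W : Finset (Fin h)) :
    (1 + C a * ∑ x ∈ V, X (Fin.castAdd h x) + C b * ∑ c ∈ W, X (Fin.natAdd h c) :
      MvPolynomial (Fin (h + h)) R).totalDegree ≤ 1 := by
  refine (totalDegree_add _ _).trans (max_le ((totalDegree_add _ _).trans (max_le ?_ ?_)) ?_)
  · rw [totalDegree_one]; exact zero_le_one
  · refine (totalDegree_mul _ _).trans ?_
    rw [totalDegree_C, zero_add]
    exact totalDegree_finsetSum_le fun x _ => (totalDegree_X _).le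
  · refine (totalDegree_mul _ _).trans ?_
    rw [totalDegree_C, zero_add]
    exact totalDegree_finsetSum_le fun x _ => (totalDegree_X _).le

/-- The image of an affine form under a change of coefficient ring is affine. -/
theorem totalDegree_map_affine_le {R S : Type*} [CommSemiring R] [CommSemiring S] [Nontrivial S]
    (f : R →+* S) (a b : R) (V W : Finset (Fin h)) :
    (MvPolynomial.map f (1 + C a * ∑ x ∈ V, X (Fin.castAdd h x) + C b * ∑ c ∈ W, X (Fin.natAdd h c) :
      MvPolynomial (Fin (h + h)) R)).totalDegree ≤ 1 := by
  simp only [map_add, map_one, map_mul, map_C, map_sum, map_X]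
  exact totalDegree_affine_le (f a) (f b) V W

/-- The scaling monomial: `s = ρ·X^{L/n}` with `−(−ρ)^n n! = 1` has `−(−s)^n n! = X^L`. -/
theorem neg_neg_C_mul_X_pow_pow (ρ : ℂ) {n L : ℕ} (hdvd : n ∣ L)
    (hρ : -((-ρ) ^ n * (n.factorial : ℂ)) = 1) :
    -((-(Polynomial.C ρ * Polynomial.X ^ (L / n))) ^ n * (n.factorial : Polynomial ℂ)) =
      Polynomial.X ^ L := by
  have e : L / n * n = L := Nat.div_mul_cancel hdvd
  have h1 : (-(Polynomial.C ρ * Polynomial.X ^ (L / n))) ^ n =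
      Polynomial.C ((-ρ) ^ n) * Polynomial.X ^ L := by
    rw [← neg_mul, ← map_neg Polynomial.C ρ, mul_pow, ← map_pow, ← pow_mul, e]
  rw [h1, ← map_natCast Polynomial.C, mul_right_comm, ← map_mul, ← neg_mul, ← map_neg, hρ, map_one,
    one_mul]

/-! ## 2. The generic design: groups, columns, determinant -/

/-- **One group of the design** (`…Prelims.coeff_partitionExpo_rootGroup` with the scaling
`−(−s)^n n! = t`): the partition coefficients of `(1 − X_V)^n`, plus `t` at `(∅, W)`. -/
theorem coeff_partitionExpo_designGroup {n : ℕ} {ζ : ℂ} (hn : n ≠ 0) (hζ : IsPrimitiveRoot ζ n)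
    (V W : Finset (Fin h)) (hW : W.card = n) (s t : Polynomial ℂ)
    (hs : -((-s) ^ n * (n.factorial : Polynomial ℂ)) = t) (S T : Finset (Fin h)) :
    coeff (∑ a ∈ S, Finsupp.single (Fin.castAdd h a) 1 +
          ∑ c ∈ T, Finsupp.single (Fin.natAdd h c) 1)
      (∏ k ∈ Finset.range n, ((1 + C (-1 : Polynomial ℂ) * ∑ a ∈ V, X (Fin.castAdd h a)) +
        C (algebraMap ℂ (Polynomial ℂ) (ζ ^ k) * s) * ∑ c ∈ W, X (Fin.natAdd h c) :
          MvPolynomial (Fin (h + h)) (Polynomial ℂ))) =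
      coeff (∑ a ∈ S, Finsupp.single (Fin.castAdd h a) 1 +
          ∑ c ∈ T, Finsupp.single (Fin.natAdd h c) 1)
        ((1 + C (-1 : Polynomial ℂ) * ∑ a ∈ V, X (Fin.castAdd h a) :
          MvPolynomial (Fin (h + h)) (Polynomial ℂ)) ^ n) + (if S = ∅ ∧ T = W then t else 0) := by
  rw [coeff_partitionExpo_rootGroup (Nat.pos_of_ne_zero hn) hζ V W hW (-1) s S T,
    coeff_partitionExpo_one_add_C_mul_sumX_pow, hs]

/-- **Column structure of a product of groups indexed by `Fin r`** (from
`…Columns.coeff_prod_group_column / _empty`, the groups with `n j = 0` being `1`): column `w j` of the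
partition matrix is `(a_j + t·ρ') · (t if n j ≠ 0 else 1)`, `a_j` the `(·, ∅)`-coefficient of the
product of the other pure parts. -/
theorem coeff_prod_groups_fin {R' : Type*} [CommRing R'] (u w : Fin r → Finset (Fin h))
    (hw : Function.Injective w) (n : Fin r → ℕ) (hn : ∀ j, n j = 0 ↔ w j = ∅)
    (G Q : Fin r → MvPolynomial (Fin (h + h)) R') (t : R')
    (hQT : ∀ (j : Fin r) (S T : Finset (Fin h)), T ≠ ∅ → coeff (∑ a ∈ S, Finsupp.single (Fin.castAdd h a) 1 +
          ∑ c ∈ T, Finsupp.single (Fin.natAdd h c) 1) (Q j) = 0)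
    (hGQ : ∀ j, n j ≠ 0 → ∀ (S T : Finset (Fin h)),
      coeff (∑ a ∈ S, Finsupp.single (Fin.castAdd h a) 1 +
          ∑ c ∈ T, Finsupp.single (Fin.natAdd h c) 1) (G j) = coeff (∑ a ∈ S, Finsupp.single (Fin.castAdd h a) 1 +
          ∑ c ∈ T, Finsupp.single (Fin.natAdd h c) 1) (Q j) + (if S = ∅ ∧ T = w j then t else 0))
    (hG1 : ∀ j, n j = 0 → G j = 1) (hQ1 : ∀ j, n j = 0 → Q j = 1) (i j : Fin r) :
    ∃ ρ' : R', coeff (∑ a ∈ u i, Finsupp.single (Fin.castAdd h a) 1 +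
          ∑ c ∈ w j, Finsupp.single (Fin.natAdd h c) 1) (∏ j', G j') =
      (coeff (∑ a ∈ u i, Finsupp.single (Fin.castAdd h a) 1 +
          ∑ c ∈ (∅ : Finset (Fin h)), Finsupp.single (Fin.natAdd h c) 1) (∏ j' ∈ (Finset.univ : Finset (Fin r)).erase j, Q j') + t * ρ') *
        (if n j ≠ 0 then t else 1) := by
  classical
  have hWne : ∀ i' : {j : Fin r // n j ≠ 0}, w i'.1 ≠ ∅ := fun i' e => i'.2 ((hn i'.1).mpr e)
  have hWinj : Function.Injective (fun i' : {j : Fin r // n j ≠ 0} => w i'.1) :=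
    fun a b e => Subtype.ext (hw e)
  have hG' : ∀ (i' : {j : Fin r // n j ≠ 0}) (S T : Finset (Fin h)),
      coeff (∑ a ∈ S, Finsupp.single (Fin.castAdd h a) 1 +
          ∑ c ∈ T, Finsupp.single (Fin.natAdd h c) 1) (G i'.1) = coeff (∑ a ∈ S, Finsupp.single (Fin.castAdd h a) 1 +
          ∑ c ∈ T, Finsupp.single (Fin.natAdd h c) 1) (Q i'.1) + (if S = ∅ ∧ T = w i'.1 then t * 1 else 0) := by
    intro i' S T
    rw [mul_one]
    exact hGQ i'.1 i'.2 S T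
  have hQ' : ∀ (i' : {j : Fin r // n j ≠ 0}) (S T : Finset (Fin h)), T ≠ ∅ →
      coeff (∑ a ∈ S, Finsupp.single (Fin.castAdd h a) 1 +
          ∑ c ∈ T, Finsupp.single (Fin.natAdd h c) 1) (Q i'.1) = 0 := fun i' S T hT => hQT i'.1 S T hT
  -- subtype products versus `Fin r` products (the missing factors are `1`)
  have hprodG : ∏ i' : {j : Fin r // n j ≠ 0}, G i'.1 = ∏ j', G j' := by
    rw [← Finset.prod_subtype (p := fun j => n j ≠ 0) (Finset.univ.filter fun j => n j ≠ 0)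
      (fun j => by simp only [Finset.mem_filter, Finset.mem_univ, true_and]) (fun j => G j)]
    exact Finset.prod_filter_of_ne fun j' _ hGj hnj => hGj (hG1 j' hnj)
  have hprodQ : ∏ i' : {j : Fin r // n j ≠ 0}, Q i'.1 = ∏ j', Q j' := by
    rw [← Finset.prod_subtype (p := fun j => n j ≠ 0) (Finset.univ.filter fun j => n j ≠ 0)
      (fun j => by simp only [Finset.mem_filter, Finset.mem_univ, true_and]) (fun j => Q j)]
    exact Finset.prod_filter_of_ne fun j' _ hQj hnj => hQj (hQ1 j' hnj)
  have hprodQerase : ∀ hj : n j ≠ 0,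
      ∏ i' ∈ (Finset.univ : Finset {j : Fin r // n j ≠ 0}).erase ⟨j, hj⟩, Q i'.1 =
        ∏ j' ∈ (Finset.univ : Finset (Fin r)).erase j, Q j' := by
    intro hj
    rw [← Finset.prod_filter_of_ne (s := (Finset.univ : Finset (Fin r)).erase j)
      (p := fun j' => n j' ≠ 0) (fun j' _ hQj hnj => hQj (hQ1 j' hnj))]
    refine Finset.prod_nbij (fun i' : {j : Fin r // n j ≠ 0} => i'.1) (fun i' hi => ?_)
      (fun a _ b _ e => Subtype.ext e) (fun j' hj' => ?_) (fun i' _ => rfl)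
    · rw [Finset.mem_filter, Finset.mem_erase]
      exact ⟨⟨fun e => (Finset.mem_erase.mp hi).1 (Subtype.ext e), Finset.mem_univ _⟩, i'.2⟩
    · rw [Finset.coe_filter] at hj'
      obtain ⟨hj'1, hj'2⟩ := hj'
      refine ⟨⟨j', hj'2⟩, Finset.mem_coe.mpr (Finset.mem_erase.mpr ⟨fun e => ?_, Finset.mem_univ _⟩),
        rfl⟩
      exact (Finset.mem_erase.mp hj'1).1 (congrArg Subtype.val e)
  by_cases hj : n j ≠ 0
  · obtain ⟨ρ', hρ'⟩ := coeff_prod_group_column (fun i' : {j : Fin r // n j ≠ 0} => G i'.1)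
      (fun i' : {j : Fin r // n j ≠ 0} => Q i'.1) (fun i' : {j : Fin r // n j ≠ 0} => w i'.1)
      (fun _ => (1 : R')) t hQ' hG' hWne hWinj Finset.univ ⟨j, hj⟩ (Finset.mem_univ _) (u i)
    have hρ'' : coeff (∑ a ∈ u i, Finsupp.single (Fin.castAdd h a) 1 +
          ∑ c ∈ w j, Finsupp.single (Fin.natAdd h c) 1) (∏ i' : {j : Fin r // n j ≠ 0}, G i'.1) =
        t * 1 * coeff (∑ a ∈ u i, Finsupp.single (Fin.castAdd h a) 1 +
          ∑ c ∈ (∅ : Finset (Fin h)), Finsupp.single (Fin.natAdd h c) 1) (∏ i' ∈ (Finset.univ : Finset {j : Fin r // n j ≠ 0}).erase ⟨j, hj⟩, Q i'.1) +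
          t * t * ρ' := hρ'
    refine ⟨ρ', ?_⟩
    rw [if_pos hj, ← hprodG, hρ'', hprodQerase hj]
    ring
  · refine ⟨0, ?_⟩
    have hj0 : n j = 0 := not_not.mp hj
    have hwj : w j = ∅ := (hn j).mp hj0
    have hemp : coeff (∑ a ∈ u i, Finsupp.single (Fin.castAdd h a) 1 +
          ∑ c ∈ (∅ : Finset (Fin h)), Finsupp.single (Fin.natAdd h c) 1) (∏ i' : {j : Fin r // n j ≠ 0}, G i'.1) =
        coeff (∑ a ∈ u i, Finsupp.single (Fin.castAdd h a) 1 +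
          ∑ c ∈ (∅ : Finset (Fin h)), Finsupp.single (Fin.natAdd h c) 1) (∏ i' : {j : Fin r // n j ≠ 0}, Q i'.1) :=
      coeff_prod_group_empty (fun i' : {j : Fin r // n j ≠ 0} => G i'.1)
        (fun i' : {j : Fin r // n j ≠ 0} => Q i'.1) (fun i' : {j : Fin r // n j ≠ 0} => w i'.1)
        (fun _ => (1 : R')) t hG' hWne Finset.univ (u i)
    rw [if_neg hj, mul_one, mul_zero, add_zero, hwj, ← hprodG, hemp, hprodQ,
      ← Finset.mul_prod_erase _ _ (Finset.mem_univ j), hQ1 j hj0, one_mul]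

/-- **Determinant of a matrix with columns `(C a_{ij} + t ρ'_{ij}) · d_j`**, `d_j ≠ 0`, `t(0) = 0`,
`det (a_{ij}) ≠ 0`: it is a nonzero polynomial. -/
theorem det_ne_zero_of_columns (A : Matrix (Fin r) (Fin r) ℂ) (hA : A.det ≠ 0)
    (M : Matrix (Fin r) (Fin r) (Polynomial ℂ)) (t : Polynomial ℂ) (ht0 : Polynomial.eval 0 t = 0)
    (d : Fin r → Polynomial ℂ) (hd : ∀ j, d j ≠ 0)
    (hM : ∀ i j, ∃ ρ' : Polynomial ℂ, M i j = (Polynomial.C (A i j) + t * ρ') * d j) :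
    M.det ≠ 0 := by
  classical
  choose R hR using hM
  set B : Matrix (Fin r) (Fin r) (Polynomial ℂ) :=
    Matrix.of fun i j => Polynomial.C (A i j) + t * R i j with hBdef
  have hMB : M = B * Matrix.diagonal d := by
    ext i j
    rw [Matrix.mul_diagonal, hBdef, Matrix.of_apply, hR i j]
  have hBdet : B.det ≠ 0 := by
    intro hB
    have e := congrArg (Polynomial.eval 0) hB
    rw [Polynomial.eval_zero, ← Polynomial.coe_evalRingHom, RingHom.map_det] at e
    have hmat : (Polynomial.evalRingHom 0).mapMatrix B = A := by
      ext i j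
      rw [RingHom.mapMatrix_apply, Matrix.map_apply, hBdef, Matrix.of_apply,
        Polynomial.coe_evalRingHom, Polynomial.eval_add, Polynomial.eval_C, Polynomial.eval_mul, ht0,
        zero_mul, add_zero]
    rw [hmat] at e
    exact hA e
  rw [hMB, Matrix.det_mul, Matrix.det_diagonal]
  exact mul_ne_zero hBdet (Finset.prod_ne_zero_iff.mpr fun j _ => hd j)

/-! ## 3. THEOREM FP -/

/-- **THEOREM FP (face-private design).** For an injective row family `u` whose range is a lower set
and ANY injective column family `w` of the same size, some product of `Σ_j |w j|` affine forms has a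
nonzero partition minor on `(u, w)`. -/
theorem chowHits_of_lowerRows (u w : Fin r → Finset (Fin h)) (hu : Function.Injective u)
    (hw : Function.Injective w) (hlow : ∀ i S, S ⊆ u i → ∃ k, u k = S) :
    ∃ ℓ : Fin (∑ j, (w j).card) → MvPolynomial (Fin (h + h)) ℂ, (∀ k, (ℓ k).totalDegree ≤ 1) ∧
      (Matrix.of fun i j : Fin r => MvPolynomial.coeff (∑ a ∈ u i, Finsupp.single (Fin.castAdd h a) 1 +
          ∑ c ∈ w j, Finsupp.single (Fin.natAdd h c) 1) (∏ k, ℓ k)).det ≠ 0 := by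
  classical
  obtain ⟨σ, hσ⟩ := exists_perm_label u w hw hlow
  set n : Fin r → ℕ := fun j => (w j).card
  have hnw : ∀ j, n j = 0 ↔ w j = ∅ := fun j => Finset.card_eq_zero
  have hn0 : ∀ j, n j = 0 → u (σ j) = ∅ := fun j hj => hσ j ((hnw j).mp hj)
  have hn_le : ∀ j, n j ≤ h := fun j => (Finset.card_le_univ _).trans (Fintype.card_fin h).le
  have hLpos : 0 < h.factorial := Nat.factorial_pos h
  have hdvd : ∀ j, n j ≠ 0 → n j ∣ h.factorial := fun j hj =>
    Nat.dvd_factorial (Nat.pos_of_ne_zero hj) (hn_le j)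
  -- roots of unity and scaling constants
  have hζ : ∀ j, n j ≠ 0 →
      IsPrimitiveRoot (Complex.exp (2 * Real.pi * Complex.I / (n j))) (n j) := fun j hj =>
    Complex.isPrimitiveRoot_exp _ hj
  have hρex : ∀ j : Fin r, ∃ ρ : ℂ, n j ≠ 0 → -((-ρ) ^ (n j) * ((n j).factorial : ℂ)) = 1 := by
    intro j
    by_cases hj : n j = 0
    · exact ⟨0, fun hh => absurd hj hh⟩
    · obtain ⟨ρ, hρ⟩ := exists_root_const (n j) (Nat.pos_of_ne_zero hj)
      exact ⟨ρ, fun _ => hρ⟩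
  choose ρ hρ using hρex
  have hs : ∀ j, n j ≠ 0 →
      -((-(Polynomial.C (ρ j) * Polynomial.X ^ (h.factorial / n j))) ^ (n j) *
        ((n j).factorial : Polynomial ℂ)) = Polynomial.X ^ h.factorial := fun j hj =>
    neg_neg_C_mul_X_pow_pow (ρ j) (hdvd j hj) (hρ j hj)
  -- the generic design over `ℂ[X]`
  set formP : Fin r → ℕ → MvPolynomial (Fin (h + h)) (Polynomial ℂ) := fun j k =>
    (1 + C (-1 : Polynomial ℂ) * ∑ a ∈ u (σ j), X (Fin.castAdd h a)) +
      C (algebraMap ℂ (Polynomial ℂ) (Complex.exp (2 * Real.pi * Complex.I / (n j)) ^ k) *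
        (Polynomial.C (ρ j) * Polynomial.X ^ (h.factorial / n j))) * ∑ c ∈ w j, X (Fin.natAdd h c)
  have hGQ : ∀ j, n j ≠ 0 → ∀ (S T : Finset (Fin h)),
      coeff (∑ a ∈ S, Finsupp.single (Fin.castAdd h a) 1 +
          ∑ c ∈ T, Finsupp.single (Fin.natAdd h c) 1) (∏ k ∈ Finset.range (n j), formP j k) =
      coeff (∑ a ∈ S, Finsupp.single (Fin.castAdd h a) 1 +
          ∑ c ∈ T, Finsupp.single (Fin.natAdd h c) 1) ((1 + C (-1 : Polynomial ℂ) * ∑ a ∈ u (σ j), X (Fin.castAdd h a) :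
          MvPolynomial (Fin (h + h)) (Polynomial ℂ)) ^ (n j)) +
        (if S = ∅ ∧ T = w j then Polynomial.X ^ h.factorial else 0) := fun j hj S T =>
    coeff_partitionExpo_designGroup hj (hζ j hj) (u (σ j)) (w j) rfl _ _ (hs j hj) S T
  have hQT : ∀ (j : Fin r) (S T : Finset (Fin h)), T ≠ ∅ →
      coeff (∑ a ∈ S, Finsupp.single (Fin.castAdd h a) 1 +
          ∑ c ∈ T, Finsupp.single (Fin.natAdd h c) 1) ((1 + C (-1 : Polynomial ℂ) * ∑ a ∈ u (σ j), X (Fin.castAdd h a) :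
          MvPolynomial (Fin (h + h)) (Polynomial ℂ)) ^ (n j)) = 0 := by
    intro j S T hT
    rw [coeff_partitionExpo_one_add_C_mul_sumX_pow, if_neg (fun hh => hT hh.1)]
  have hG1 : ∀ j, n j = 0 → ∏ k ∈ Finset.range (n j), formP j k = 1 := fun j hj => by
    rw [hj, Finset.range_zero, Finset.prod_empty]
  have hQ1 : ∀ j, n j = 0 →
      ((1 + C (-1 : Polynomial ℂ) * ∑ a ∈ u (σ j), X (Fin.castAdd h a) :
          MvPolynomial (Fin (h + h)) (Polynomial ℂ)) ^ (n j)) = 1 := fun j hj => by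
    rw [hj, pow_zero]
  have hcol := coeff_prod_groups_fin u w hw n hnw (fun j => ∏ k ∈ Finset.range (n j), formP j k)
    (fun j => ((1 + C (-1 : Polynomial ℂ) * ∑ a ∈ u (σ j), X (Fin.castAdd h a) :
        MvPolynomial (Fin (h + h)) (Polynomial ℂ)) ^ (n j)))
    (Polynomial.X ^ h.factorial) hQT hGQ hG1 hQ1
  -- the leading matrix over `ℂ`
  set A : Matrix (Fin r) (Fin r) ℂ := Matrix.of fun i j => coeff (∑ a ∈ u i, Finsupp.single (Fin.castAdd h a) 1 +
          ∑ c ∈ (∅ : Finset (Fin h)), Finsupp.single (Fin.natAdd h c) 1)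
    (∏ j' ∈ (Finset.univ : Finset (Fin r)).erase j,
      ((1 + C (-1 : ℂ) * ∑ a ∈ u (σ j'), X (Fin.castAdd h a)) ^ (n j') :
        MvPolynomial (Fin (h + h)) ℂ)) with hAdef
  have hAdet : A.det ≠ 0 := det_leadingMatrix_ne_zero u hu hlow σ n hn0
  have hQmap : ∀ j', ((1 + C (-1 : Polynomial ℂ) * ∑ a ∈ u (σ j'), X (Fin.castAdd h a)) ^ (n j') :
      MvPolynomial (Fin (h + h)) (Polynomial ℂ)) =
      MvPolynomial.map Polynomial.C
        (((1 + C (-1 : ℂ) * ∑ a ∈ u (σ j'), X (Fin.castAdd h a)) ^ (n j') :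
          MvPolynomial (Fin (h + h)) ℂ)) := by
    intro j'
    simp only [map_pow, map_add, map_one, map_mul, map_sum, map_X, map_neg]
  have hAentry : ∀ i j, coeff (∑ a ∈ u i, Finsupp.single (Fin.castAdd h a) 1 +
          ∑ c ∈ (∅ : Finset (Fin h)), Finsupp.single (Fin.natAdd h c) 1) (∏ j' ∈ (Finset.univ : Finset (Fin r)).erase j,
      ((1 + C (-1 : Polynomial ℂ) * ∑ a ∈ u (σ j'), X (Fin.castAdd h a)) ^ (n j') :
        MvPolynomial (Fin (h + h)) (Polynomial ℂ))) = Polynomial.C (A i j) := by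
    intro i j
    rw [hAdef, Matrix.of_apply, Finset.prod_congr rfl (fun j' _ => hQmap j'), ← map_prod, coeff_map]
  -- the partition matrix of the generic design is a nonzero polynomial
  have hdet : (Matrix.of fun i j : Fin r =>
      coeff (∑ a ∈ u i, Finsupp.single (Fin.castAdd h a) 1 +
          ∑ c ∈ w j, Finsupp.single (Fin.natAdd h c) 1) (∏ j', ∏ k ∈ Finset.range (n j'), formP j' k)).det ≠ 0 := by
    refine det_ne_zero_of_columns A hAdet _ (Polynomial.X ^ h.factorial)
      (by rw [Polynomial.eval_pow, Polynomial.eval_X, zero_pow hLpos.ne'])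
      (fun j => if n j ≠ 0 then Polynomial.X ^ h.factorial else 1) (fun j => ?_) (fun i j => ?_)
    · show (if n j ≠ 0 then Polynomial.X ^ h.factorial else (1 : Polynomial ℂ)) ≠ 0
      by_cases hj : n j ≠ 0
      · rw [if_pos hj]; exact pow_ne_zero _ Polynomial.X_ne_zero
      · rw [if_neg hj]; exact one_ne_zero
    · obtain ⟨ρ', hρ'⟩ := hcol i j
      refine ⟨ρ', ?_⟩
      rw [Matrix.of_apply, ← hAentry i j]
      exact hρ'
  -- a complex evaluation point where the determinant does not vanish
  obtain ⟨x₀, hx₀⟩ : ∃ x₀ : ℂ, Polynomial.eval x₀ (Matrix.of fun i j : Fin r =>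
      coeff (∑ a ∈ u i, Finsupp.single (Fin.castAdd h a) 1 +
          ∑ c ∈ w j, Finsupp.single (Fin.natAdd h c) 1) (∏ j', ∏ k ∈ Finset.range (n j'), formP j' k)).det ≠ 0 := by
    by_contra hall
    exact hdet (Polynomial.funext fun x => by
      rw [Polynomial.eval_zero]; exact not_not.mp fun hx => hall ⟨x, hx⟩)
  -- the witness: the design evaluated at `x₀`, indexed by `Fin (Σ_j n j)`
  refine ⟨fun q => MvPolynomial.map (Polynomial.evalRingHom x₀)
      (formP (finSigmaFinEquiv.symm q).1 ((finSigmaFinEquiv.symm q).2 : ℕ)),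
    fun q => totalDegree_map_affine_le _ _ _ _ _, ?_⟩
  have hprod : (∏ q : Fin (∑ j, n j), MvPolynomial.map (Polynomial.evalRingHom x₀)
      (formP (finSigmaFinEquiv.symm q).1 ((finSigmaFinEquiv.symm q).2 : ℕ))) =
      MvPolynomial.map (Polynomial.evalRingHom x₀) (∏ j', ∏ k ∈ Finset.range (n j'), formP j' k) := by
    rw [map_prod, Equiv.prod_comp finSigmaFinEquiv.symm (fun p : (Σ j : Fin r, Fin (n j)) =>
        MvPolynomial.map (Polynomial.evalRingHom x₀) (formP p.1 (p.2 : ℕ))),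
      Fintype.prod_sigma' (fun (j : Fin r) (k : Fin (n j)) =>
        MvPolynomial.map (Polynomial.evalRingHom x₀) (formP j (k : ℕ)))]
    refine Finset.prod_congr rfl fun j _ => ?_
    rw [map_prod]
    exact Fin.prod_univ_eq_prod_range
      (fun k => MvPolynomial.map (Polynomial.evalRingHom x₀) (formP j k)) (n j)
  have hmat : (Matrix.of fun i j : Fin r => MvPolynomial.coeff (∑ a ∈ u i, Finsupp.single (Fin.castAdd h a) 1 +
          ∑ c ∈ w j, Finsupp.single (Fin.natAdd h c) 1)
      (∏ q : Fin (∑ j, n j), MvPolynomial.map (Polynomial.evalRingHom x₀)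
        (formP (finSigmaFinEquiv.symm q).1 ((finSigmaFinEquiv.symm q).2 : ℕ)))) =
      (Polynomial.evalRingHom x₀).mapMatrix (Matrix.of fun i j : Fin r =>
        coeff (∑ a ∈ u i, Finsupp.single (Fin.castAdd h a) 1 +
          ∑ c ∈ w j, Finsupp.single (Fin.natAdd h c) 1) (∏ j', ∏ k ∈ Finset.range (n j'), formP j' k)) := by
    ext i j
    rw [Matrix.of_apply, hprod, coeff_map, RingHom.mapMatrix_apply, Matrix.map_apply, Matrix.of_apply]
  rw [hmat, ← RingHom.map_det, Polynomial.coe_evalRingHom]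
  exact hx₀

/-- Lower-set range in the item's `IsLowerSet` spelling gives the face-closure used above. -/
theorem exists_row_of_subset (u : Fin r → Finset (Fin h)) (hlow : IsLowerSet (Set.range u))
    (i : Fin r) (S : Finset (Fin h)) (hS : S ⊆ u i) : ∃ k, u k = S := by
  have : S ∈ Set.range u := hlow (show S ≤ u i from hS) (Set.mem_range_self i)
  obtain ⟨k, hk⟩ := this
  exact ⟨k, hk⟩

end

end Summit.ValiantsHypothesis.ValiantsHypothesis.Theorems.BarrierLever.ChowFacePrivate
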